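import Summits.QuantumFields.YangMills.Theorems.BalabanLadderUVSeamRecCeilingsBlockFieldLocality
import Summits.QuantumFields.YangMills.Theorems.BalabanLadderUVSeamRecCeilingsDLRPeelingSemiclassical
import Summits.QuantumFields.YangMills.Theorems.BalabanLadderNTBoundaryLawCentred
import HarnessLib

/-!
# Crux `UVSeamRec` (stmt-QuantumFields-20043), lane B: COLLAR BOOKKEEPING for the one-box hypothesis (UCR) — monotonicity in the collar
# (DLR consistency) and the fixed-scale semiclassical rung for every block size with collar `m ≥ 4`

Helper file (`--supports stmt-QuantumFields-20043`) of the width-lever seat `ym-20043-ceilings-p2` (lane B, gen 7); sequel of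
`…CeilingsBlockFieldLocality` (true support `b^k y + [0,4b^k)⁴` of the block-field events), `…CeilingsDLRPeelingSemiclassical` (g6: (UCR_k) at a
fixed scale from the classical no-penetration property, collar `m ≥ b+1`) and the NT tools `NT.BoundaryLaw.kerE_kerE_of_subset` (DLR consistency in
kernel-mean form).

§1 MONOTONICITY.  A cube-kernel bound UNIFORM IN THE EXTERIOR for a nonnegative bounded measurable observable passes to every LARGER cube
(`kerE_le_of_forall_kerE_le_of_subset`: consistency `γ_Q = γ_Q γ_{Q'}` and `γ_Q` is a probability); hence (UCR) at collar `m` implies (UCR) at every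
collar `m' ≥ m` with the SAME weight (`uniformConditionalRarity_mono_collar`): the hypotheses of the any-collar v8 glue
(`responseMomentsOdd6SU2_of_splitCl_gaussianDomination_uniformConditionalRarity_anyCollar`) are ORDERED in `m` — the smallest collar a supplier can
reach is the strongest statement, and nothing is lost by quantifying `∃ m ≥ 3`.
§2 THE SEMICLASSICAL RUNG FOR EVERY BLOCK SIZE.  With the true support, the links read by N20's large-field event of `(k, y, μ<ν)` are INTERIOR links
of the collar cube as soon as `m ≥ 4` (`localBox_subset_cubeEdges`), so g6's `uniformConditionalRarity_of_classicalNoPenetration` holds with collar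
`m ≥ 4` for EVERY odd block size (`uniformConditionalRarity_of_classicalNoPenetration_smallCollar`): (UCR_k) at a fixed scale with weight `C e^{−βΔ}`
from the classical no-penetration property of the collar cube `(b^k(y−m), (2m+1)b^k)`.

HONEST FRAMING.  Folklore probability (DLR consistency; Laplace principle via g6); (UCR) itself and the classical no-penetration property are OPEN
(the latter numerically delicate: flat penetration forces central block fields up to `≈ π⁴/(2(2m+1)⁴)`, LEAD 20043 FINDING #50); nothing of E0′;
not a gap, not Clay.  References: Georgii 2011 Def. 1.23 (iii); folklore.
-/

set_option autoImplicit false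

noncomputable section

open MeasureTheory Filter Topology Set
open Literature.Probability.LatticeModels
open Literature.MathematicalPhysics.QuantumFieldTheory (GaugeConfig LatticeRep)
open Literature.MathematicalPhysics.QuantumLattice (LGConfig IsCylinder ymSpecification isProbabilityMeasure_ymSpecification
  integrable_of_abs_le wilsonBoundaryAction)

namespace Summit.QuantumFields.YangMills.Cruxes.UVSeamRec.DLRPeeling

open Summit.QuantumFields.YangMills.Cruxes.OSLegsFromFemtoAndGap.DlrCollarTransfer
open Summit.QuantumFields.YangMills.Cruxes.OSLegsFromFemtoAndGap.DlrCollarTransfer.StubLower (mem_cubeSites_iff)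
open Summit.QuantumFields.YangMills.Cruxes.UVSeamRec.PolymerData
open Summit.QuantumFields.YangMills.Cruxes.UVSeamRec.BlockFieldLocality
open Summit.QuantumFields.YangMills.Cruxes.NT.BoundaryLaw (cubeSites_subset cubeEdges_subset kerE_kerE_of_subset)

/-! ## §1 Monotonicity of exterior-uniform cube-kernel bounds in the cube; (UCR) is monotone in the collar -/

section Mono

variable (G : Type) [Group G] [TopologicalSpace G] [IsTopologicalGroup G] [CompactSpace G]
  [MeasurableSpace G] [BorelSpace G] (r : LatticeRep G)

/-- **An exterior-uniform kernel bound passes to larger cubes.**  Nested cubes `Q' ⊆ Q` (interior links of `Q'` among those of `Q`), a bounded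
measurable observable `F ≥ 0`; if `kerE^ζ_{Q'}(F) ≤ w` for EVERY exterior `ζ`, then `kerE^η_Q(F) ≤ w` for every exterior `η`:
`kerE^η_Q(F) = kerE^η_Q(kerE^{·}_{Q'}(F))` (DLR consistency, `NT.BoundaryLaw.kerE_kerE_of_subset`) and `γ_Q(·|η)` is a probability measure.
[cite: Georgii2011, Def. 1.23 (iii) (consistency)] -/
theorem kerE_le_of_forall_kerE_le_of_subset (β : ℝ) {c c' : Fin 4 → ℤ} {b b' : ℕ} (hsub : cubeEdges c' b' ⊆ cubeEdges c b)
    {F : LGConfig 4 G → ℝ} (hF : Measurable F) (hF0 : ∀ U, 0 ≤ F U) {M : ℝ} (hM : ∀ U, |F U| ≤ M) {w : ℝ}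
    (h : ∀ ζ : LGConfig 4 G, kerE G r β c' b' ζ F ≤ w) (η : LGConfig 4 G) : kerE G r β c b η F ≤ w := by
  haveI := r.secondCountableTopology
  haveI := isProbabilityMeasure_ymSpecification r.ρ r.continuous β (cubeEdges c b) η
  rw [← kerE_kerE_of_subset G r β hsub η hF hM]
  have hg0 : ∀ U, 0 ≤ kerE G r β c' b' U F := fun U => by
    unfold kerE; exact integral_nonneg fun V => hF0 V
  unfold kerE
  calc ∫ U, kerE G r β c' b' U F ∂(ymSpecification (d := 4) r.ρ β (cubeEdges c b) η)
      ≤ ∫ _U, w ∂(ymSpecification (d := 4) r.ρ β (cubeEdges c b) η) :=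
        integral_mono_of_nonneg (ae_of_all _ hg0) (integrable_const w) (ae_of_all _ h)
    _ = w := by rw [integral_const, smul_eq_mul, probReal_univ, one_mul]

omit [IsTopologicalGroup G] [CompactSpace G] [MeasurableSpace G] [BorelSpace G] in
/-- The collar cubes of one block are nested: for `m ≤ m'`, the cube of corner `b^k(y−m)` and side `(2m+1)b^k` sits in the cube of corner
`b^k(y−m')` and side `(2m'+1)b^k`. [folklore] -/
theorem collarCube_subset (𝔟 : BlockSize) (k : ℕ) (y : Fin 4 → ℤ) {m m' : ℕ} (hmm : m ≤ m') :
    cubeSites (fun i => (𝔟.b : ℤ) ^ k * (y i - m)) ((2 * m + 1) * 𝔟.b ^ k) ⊆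
      cubeSites (fun i => (𝔟.b : ℤ) ^ k * (y i - m')) ((2 * m' + 1) * 𝔟.b ^ k) := by
  refine cubeSites_subset fun j => ?_
  have hbk : (1 : ℤ) ≤ (𝔟.b : ℤ) ^ k := 𝔟.one_le_pow k
  have hmm' : (m : ℤ) ≤ m' := by exact_mod_cast hmm
  push_cast
  constructor <;> nlinarith

variable {N : ℕ} [NeZero N]

/-- **(UCR) IS MONOTONE IN THE COLLAR.**  `SU(N)`, any lattice representation `r`, any `β`; block size `𝔟`, threshold `ε`, level `k`, block index `y`,
orientation `μ<ν`.  If the one-box bound holds with collar `m` — `kerE^ζ_{(b^k(y−m),(2m+1)b^k)}(1_{largeFieldEvent 𝔟 ε (k,y,μ,ν)}) ≤ w` for EVERY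
exterior `ζ` — then it holds with every collar `m' ≥ m` and the same weight `w`, for every exterior.  So the hypotheses (UCR) of the v8 glue at
different collars are ordered: the smallest collar is the strongest statement; a consumer quantifying `∃ m ≥ 3` loses nothing.
[cite: Georgii2011, Def. 1.23 (iii) (consistency)] -/
theorem uniformConditionalRarity_mono_collar (r : LatticeRep (Matrix.specialUnitaryGroup (Fin N) ℂ)) (β : ℝ) (𝔟 : BlockSize) (ε : ℝ)
    (k : ℕ) (y : Fin 4 → ℤ) (μ ν : Fin 4) (hμν : μ < ν) {m m' : ℕ} (hmm : m ≤ m') {w : ℝ}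
    (h : ∀ ζ : LGConfig 4 (Matrix.specialUnitaryGroup (Fin N) ℂ),
      kerE (Matrix.specialUnitaryGroup (Fin N) ℂ) r β (fun i => (𝔟.b : ℤ) ^ k * (y i - m)) ((2 * m + 1) * 𝔟.b ^ k) ζ
        ((largeFieldEvent (N := N) 𝔟 ε ⟨k, y, μ, ν, hμν⟩).indicator fun _ => (1 : ℝ)) ≤ w)
    (η : LGConfig 4 (Matrix.specialUnitaryGroup (Fin N) ℂ)) :
    kerE (Matrix.specialUnitaryGroup (Fin N) ℂ) r β (fun i => (𝔟.b : ℤ) ^ k * (y i - m')) ((2 * m' + 1) * 𝔟.b ^ k) η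
      ((largeFieldEvent (N := N) 𝔟 ε ⟨k, y, μ, ν, hμν⟩).indicator fun _ => (1 : ℝ)) ≤ w := by
  classical
  refine kerE_le_of_forall_kerE_le_of_subset (Matrix.specialUnitaryGroup (Fin N) ℂ) r β
    (cubeEdges_subset (collarCube_subset 𝔟 k y hmm))
    (measurable_const.indicator (measurableSet_largeFieldEvent (N := N) 𝔟 ε _))
    (fun U => Set.indicator_nonneg (fun _ _ => zero_le_one) _) (M := 1) (fun U => ?_) h η
  rw [abs_of_nonneg (Set.indicator_nonneg (fun _ _ => zero_le_one) _)]
  exact Set.indicator_apply_le' (fun _ => le_rfl) (fun _ => zero_le_one)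

end Mono

/-! ## §2 The fixed-scale semiclassical rung for every block size: collar `m ≥ 4` -/

section Semiclassical

variable {N : ℕ} [NeZero N]

omit [NeZero N] in
/-- With collar `m ≥ 4` the TRUE support box `b^k y + [0,4b^k)⁴` of the central `k`-block's field is made of INTERIOR links of the collar cube
(corner `b^k(y − m)`, side `(2m+1)b^k`) — for every odd block size (replacing `chartBox_subset_cubeEdges`, which needs `m ≥ b + 1`). [folklore] -/
theorem localBox_subset_cubeEdges (𝔟 : BlockSize) (m : ℕ) (hm : 4 ≤ m) (k : ℕ) (y : Fin 4 → ℤ) :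
    (Fintype.piFinset fun i => Finset.Ico ((𝔟.b : ℤ) ^ k * y i) ((𝔟.b : ℤ) ^ k * y i + 4 * (𝔟.b : ℤ) ^ k)) ×ˢ
        (Finset.univ : Finset (Fin 4)) ⊆
      cubeEdges (fun i => (𝔟.b : ℤ) ^ k * (y i - m)) ((2 * m + 1) * 𝔟.b ^ k) := by
  intro e he
  have he' := fun j => Finset.mem_Ico.1 (Fintype.mem_piFinset.1 (Finset.mem_product.1 he).1 j)
  have hbk : (1 : ℤ) ≤ (𝔟.b : ℤ) ^ k := 𝔟.one_le_pow k
  have hm' : (4 : ℤ) ≤ m := by exact_mod_cast hm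
  have hside : (((2 * m + 1) * 𝔟.b ^ k : ℕ) : ℤ) = (2 * m + 1) * (𝔟.b : ℤ) ^ k := by push_cast; ring
  have hwin : ∀ j, (𝔟.b : ℤ) ^ k * (y j - m) ≤ e.1 j ∧ e.1 j + 1 < (𝔟.b : ℤ) ^ k * (y j - m) + (((2 * m + 1) * 𝔟.b ^ k : ℕ) : ℤ) := by
    intro j
    have h := he' j
    rw [hside]
    have e2 : (𝔟.b : ℤ) ^ k * (y j - m) = (𝔟.b : ℤ) ^ k * y j - (m : ℤ) * (𝔟.b : ℤ) ^ k := by ring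
    have hprod : 0 ≤ ((m : ℤ) - 4) * (𝔟.b : ℤ) ^ k := mul_nonneg (by linarith) (by linarith)
    rw [e2]
    constructor
    · nlinarith [h.1]
    · nlinarith [h.2]
  unfold cubeEdges
  refine Finset.mem_filter.2 ⟨Finset.mem_product.2 ⟨(mem_cubeSites_iff _ _ _).2 fun j => ⟨(hwin j).1, by linarith [(hwin j).2]⟩,
    Finset.mem_univ _⟩, (mem_cubeSites_iff _ _ _).2 fun j => ?_⟩
  have hs : (Pi.single e.2 (1 : ℤ) : Fin 4 → ℤ) j = 0 ∨ (Pi.single e.2 (1 : ℤ) : Fin 4 → ℤ) j = 1 := by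
    rcases eq_or_ne j e.2 with rfl | hj
    · exact Or.inr (by simp)
    · exact Or.inl (by simp [Pi.single_eq_of_ne hj])
  rcases hs with h0 | h1
  · simp only [Pi.add_apply, h0, add_zero]; exact ⟨(hwin j).1, by linarith [(hwin j).2]⟩
  · simp only [Pi.add_apply, h1]; exact ⟨by linarith [(hwin j).1], (hwin j).2⟩

/-- **(UCR_k) AT A FIXED SCALE FROM THE CLASSICAL NO-PENETRATION PROPERTY — EVERY BLOCK SIZE, COLLAR `m ≥ 4`.**  `SU(N)`, any lattice
representation `r`; ANY odd block size `𝔟`, collar `m ≥ 4`, threshold `ε`, level `k`, block index `y`, orientation `μ < ν`; the collar cube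
`Q = (b^k(y−m), (2m+1)b^k)`.  Read N20's large-field event on the interior links of `Q`: `E := closure {ζ ∈ G^Q | ζ ∨ 1 ∈ largeFieldEvent 𝔟 ε (k,y,μ,ν)}`.
CLASSICAL HYPOTHESIS (zero temperature, no penetration of the central block): for EVERY exterior `η`, no minimiser of the boundary Wilson action
`ζ ↦ S_Q(ζ ∨ η)` lies in `E`.  THEN there are `C ≥ 0`, `Δ > 0` with `kerE^η_Q(1_{largeFieldEvent 𝔟 ε (k,y,μ,ν)}) ≤ C e^{−βΔ}` for all `β ≥ 0` and ALL
exteriors `η`.  Proof = g6's `uniformConditionalRarity_of_classicalNoPenetration` with the true support of the event (`isCylinder_indicator_largeFieldEvent_local`,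
`localBox_subset_cubeEdges`).  HONEST FRAMING: fixed scale only (constants depend on `k`, `m`, `b`); the classical hypothesis is OPEN and numerically
delicate (flat penetration, LEAD FINDING #50); the k-uniform summability asked by (RM) is the RG content. [folklore] -/
theorem uniformConditionalRarity_of_classicalNoPenetration_smallCollar (r : LatticeRep (Matrix.specialUnitaryGroup (Fin N) ℂ))
    (𝔟 : BlockSize) (m : ℕ) (hm : 4 ≤ m) (ε : ℝ) (k : ℕ) (y : Fin 4 → ℤ) (μ ν : Fin 4) (hμν : μ < ν)
    (havoid : ∀ (η : LGConfig 4 (Matrix.specialUnitaryGroup (Fin N) ℂ))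
      (ζ : ↥(cubeEdges (fun i => (𝔟.b : ℤ) ^ k * (y i - m)) ((2 * m + 1) * 𝔟.b ^ k)) → Matrix.specialUnitaryGroup (Fin N) ℂ),
      (∀ ζ', wilsonBoundaryAction r.ρ (cubeEdges (fun i => (𝔟.b : ℤ) ^ k * (y i - m)) ((2 * m + 1) * 𝔟.b ^ k))
            (glueWith (cubeEdges (fun i => (𝔟.b : ℤ) ^ k * (y i - m)) ((2 * m + 1) * 𝔟.b ^ k)) ζ η) ≤
          wilsonBoundaryAction r.ρ (cubeEdges (fun i => (𝔟.b : ℤ) ^ k * (y i - m)) ((2 * m + 1) * 𝔟.b ^ k))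
            (glueWith (cubeEdges (fun i => (𝔟.b : ℤ) ^ k * (y i - m)) ((2 * m + 1) * 𝔟.b ^ k)) ζ' η)) →
        ζ ∉ closure {ζ | glueWith (cubeEdges (fun i => (𝔟.b : ℤ) ^ k * (y i - m)) ((2 * m + 1) * 𝔟.b ^ k)) ζ
          (1 : LGConfig 4 (Matrix.specialUnitaryGroup (Fin N) ℂ)) ∈ largeFieldEvent (N := N) 𝔟 ε ⟨k, y, μ, ν, hμν⟩}) :
    ∃ C Δ : ℝ, 0 ≤ C ∧ 0 < Δ ∧ ∀ β : ℝ, 0 ≤ β → ∀ η : LGConfig 4 (Matrix.specialUnitaryGroup (Fin N) ℂ),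
      kerE (Matrix.specialUnitaryGroup (Fin N) ℂ) r β (fun i => (𝔟.b : ℤ) ^ k * (y i - m)) ((2 * m + 1) * 𝔟.b ^ k) η
        ((largeFieldEvent (N := N) 𝔟 ε ⟨k, y, μ, ν, hμν⟩).indicator fun _ => (1 : ℝ)) ≤ C * Real.exp (-β * Δ) := by
  classical
  haveI := r.secondCountableTopology
  set Λ := cubeEdges (fun i => (𝔟.b : ℤ) ^ k * (y i - m)) ((2 * m + 1) * 𝔟.b ^ k) with hΛ
  set γ : Polymer := ⟨k, y, μ, ν, hμν⟩ with hγ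
  set E : Set (↥Λ → Matrix.specialUnitaryGroup (Fin N) ℂ) :=
    closure {ζ | glueWith Λ ζ (1 : LGConfig 4 (Matrix.specialUnitaryGroup (Fin N) ℂ)) ∈ largeFieldEvent (N := N) 𝔟 ε γ} with hEdef
  obtain ⟨C, Δ, hC, hΔ, h⟩ := kerE_indicator_le_exp_of_minimisers_avoid (Matrix.specialUnitaryGroup (Fin N) ℂ) r
    (fun i => (𝔟.b : ℤ) ^ k * (y i - m)) ((2 * m + 1) * 𝔟.b ^ k) (E := E) isClosed_closure havoid
  refine ⟨C, Δ, hC, hΔ, fun β hβ η => le_trans ?_ (h β hβ η)⟩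
  -- monotonicity: the large-field event is contained in `{U : U|_Λ ∈ E}` (a cylinder on the true support box ⊆ Λ)
  haveI := isProbabilityMeasure_ymSpecification r.ρ r.continuous β Λ η
  have hsub : largeFieldEvent (N := N) 𝔟 ε γ ⊆ {U : LGConfig 4 (Matrix.specialUnitaryGroup (Fin N) ℂ) | (fun e : ↥Λ => U e) ∈ E} := by
    intro U hU
    refine subset_closure ?_
    show glueWith Λ (fun e : ↥Λ => U e) 1 ∈ largeFieldEvent (N := N) 𝔟 ε γ
    have hcyl := isCylinder_indicator_largeFieldEvent_local (N := N) 𝔟 ε γ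
    have hagree : ∀ e ∈ (((Fintype.piFinset fun i => Finset.Ico ((𝔟.b : ℤ) ^ γ.k * γ.y i)
        ((𝔟.b : ℤ) ^ γ.k * γ.y i + 4 * (𝔟.b : ℤ) ^ γ.k)) ×ˢ (Finset.univ : Finset (Fin 4)) :
          Finset (Literature.MathematicalPhysics.QuantumLattice.ZdEdge 4)) : Set _),
        glueWith Λ (fun e : ↥Λ => U e) 1 e = U e := by
      intro e he
      have heΛ : e ∈ Λ := localBox_subset_cubeEdges 𝔟 m hm k y (Finset.mem_coe.1 he)
      rw [glueWith_apply_mem _ _ _ heΛ]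
    have hval := hcyl hagree
    have h1 : (largeFieldEvent (N := N) 𝔟 ε γ).indicator (fun _ => (1 : ℝ)) U = 1 := by simp [hU]
    rw [h1] at hval
    by_contra hnot
    simp [hnot] at hval
  have hEm : MeasurableSet {U : LGConfig 4 (Matrix.specialUnitaryGroup (Fin N) ℂ) | (fun e : ↥Λ => U e) ∈ E} :=
    (measurable_pi_lambda _ fun e => measurable_pi_apply _) isClosed_closure.measurableSet
  unfold kerE
  refine integral_mono_of_nonneg (ae_of_all _ fun U => Set.indicator_nonneg (fun _ _ => zero_le_one) _)
    ((integrable_const (1 : ℝ)).indicator hEm) (ae_of_all _ fun U => ?_)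
  exact Set.indicator_le_indicator_of_subset hsub (fun _ => zero_le_one) U

end Semiclassical

end Summit.QuantumFields.YangMills.Cruxes.UVSeamRec.DLRPeeling

end
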